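import Mathlib
import HarnessLib
import HarnessLib.Audit
import Summits.AtomisticToContinuum.Statement
import Literature.MathematicalPhysics.QuantumLattice.XYOrder
import Literature.MathematicalPhysics.QuantumManyBody.PeriodicBoseGas

/-!
Route: BECFillingMonotone

CLOSED (retired) 2026-08-15T13:38:43Z by operator:999:1257524 — reason: not-a-thesis: assembly does not conclude the sub-problem Statement — note: D-0027 §2.1 audit (human 2026-08-15: routes that do not decide the summit are removed): the assembly concludes `Literature.MathematicalPhysics.QuantumManyBody.BoseGas.BoseEinsteinCondensation`, not the sub-problem statement; a NEW conforming route may be opened from the same idea (generated `closes . The file is kept as the record of this route; refuted decls are indexed as negative knowledge (`ledger negatives`).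

# Route BECFillingMonotone — KLS half-filling anchor carried to every filling by two
sector-comparison inequalities, then a dilute-filling depth bridge to the continuum torus

It suffices to show X = X_lat ∧ X_bridge ∧ X_bc (card kls-anchor-filling-monotone, spine; the bridge
is the dilute-filling reading of the
sibling card optical-lattice-depth-homotopy). X_lat (UniformLatticeBEC, the LSSY Ch. 11 open problem
"BEC at other fillings", T = 0):
for every d ≥ 2 there are c > 0 and L₀ such that on every even torus (ℤ/Lℤ)^d, L ≥ L₀, the ground
state of N hard-core bosons
(= spin-½ XY ferromagnet `xyTorus d L 1` in the sector S³_tot = N − L^d/2, encoded WITHOUT new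
definitions as the ground space of the
penalised Hamiltonian H + (d+1)L^d·(S³_tot + (L^d/2 − N)·1)², penalty > spectral width d·L^d) has
⟨S⁺_tot S⁻_tot⟩ ≥ c·N·L^d for all
1 ≤ N ≤ L^d/2, i.e. λ_max(γ_N) ≥ cN uniformly in the filling (⟨S⁺_tot S⁻_tot⟩ = Σ_{x,y}γ_N(x,y) =
V·λ_max by translation invariance and
positivity; typed as A_L(N) + N − L^d/2 with A_L(N) = ⟨(S¹_tot)²+(S²_tot)²⟩_N the planar moment).
X_lat follows from the KLS theorem of the
tree (anchor at S³_tot = 0) and TWO SECTOR-COMPARISON INEQUALITIES: (M) FractionDominatesHalfFilling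
— no filling below one half has a
smaller condensate fraction than half filling; (D) HalfFillingMaximisesMoment — the
particle–hole-symmetric sector maximises the planar
moment; plus the provable SectorMixtureBound (the tracial all-sector KLS state is dominated by one
sector). X_bridge (LatticeToPeriodicBridge):
X_lat at d = 3 ⇒ PeriodicBEC (constant-mode condensation of periodic near-minimisers of the
continuum gas at small ρ). X_bc = BoundaryTransferWeak
(item stmt-AtomisticToContinuum-0827 of route BECPeriodicReduction, verbatim): PeriodicBEC(v) ⇒
HasGroundStateBEC v ρ for small ρ.
Lean: `(∀ d : ℕ, 2 ≤ d → ∃ c : ℝ, 0 < c ∧ ∃ L₀ : ℕ, ∀ (L : ℕ) [NeZero L], L₀ ≤ L → Even L → ∀ N : ℕ,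
1 ≤ N → 2 * N ≤ L ^ d → c * N * (L : ℝ) ^ d ≤
((Literature.MathematicalPhysics.QuantumLattice.xyTorus d L 1 + (((d + 1) * L ^ d : ℕ) : ℂ) •
(Literature.MathematicalPhysics.QuantumLattice.totalSpin 1 2 + ((L : ℂ) ^ d / 2 - (N : ℂ)) • 1) ^
2).groundStateFunctional (Literature.MathematicalPhysics.QuantumLattice.totalSpin 1 0 *
Literature.MathematicalPhysics.QuantumLattice.totalSpin 1 0 +
Literature.MathematicalPhysics.QuantumLattice.totalSpin 1 1 *
Literature.MathematicalPhysics.QuantumLattice.totalSpin 1 1)).re + N - (L : ℝ) ^ d / 2) ∧ ((∃ c : ℝ,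
0 < c ∧ ∃ L₀ : ℕ, ∀ (L : ℕ) [NeZero L], L₀ ≤ L → Even L → ∀ N : ℕ, 1 ≤ N → 2 * N ≤ L ^ 3 → c * N *
(L : ℝ) ^ 3 ≤ ((Literature.MathematicalPhysics.QuantumLattice.xyTorus 3 L 1 + (((3 + 1) * L ^ 3 : ℕ)
: ℂ) • (Literature.MathematicalPhysics.QuantumLattice.totalSpin 1 2 + ((L : ℂ) ^ 3 / 2 - (N : ℂ)) •
1) ^ 2).groundStateFunctional (Literature.MathematicalPhysics.QuantumLattice.totalSpin 1 0 *
Literature.MathematicalPhysics.QuantumLattice.totalSpin 1 0 +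
Literature.MathematicalPhysics.QuantumLattice.totalSpin 1 1 *
Literature.MathematicalPhysics.QuantumLattice.totalSpin 1 1)).re + N - (L : ℝ) ^ 3 / 2) → ∀ v : ℝ →
ENNReal, Literature.MathematicalPhysics.QuantumManyBody.BoseGas.IsRepulsiveFiniteRange v → ∃ ρ₀ : ℝ,
0 < ρ₀ ∧ ∀ ρ : ℝ, 0 < ρ → ρ < ρ₀ → ∃ c : ℝ, 0 < c ∧ ∀ᶠ N : ℕ in Filter.atTop, ∃ δ : ENNReal, 0 < δ ∧
∀ Ψ : Literature.MathematicalPhysics.QuantumManyBody.BoseGas.PeriodicTrialState N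
(Literature.MathematicalPhysics.QuantumManyBody.BoseGas.sideLength ρ N),
Literature.MathematicalPhysics.QuantumManyBody.BoseGas.periodicEnergy v Ψ ≤
Literature.MathematicalPhysics.QuantumManyBody.BoseGas.periodicGroundStateEnergy v N
(Literature.MathematicalPhysics.QuantumManyBody.BoseGas.sideLength ρ N) + δ → ENNReal.ofReal (c * N)
≤ Literature.MathematicalPhysics.QuantumManyBody.BoseGas.condensateOccupation N
(Literature.MathematicalPhysics.QuantumManyBody.BoseGas.sideLength ρ N) Ψ.ψ) ∧ (∀ v : ℝ → ENNReal,
Literature.MathematicalPhysics.QuantumManyBody.BoseGas.IsRepulsiveFiniteRange v → (∃ ρ₀ : ℝ, 0 < ρ₀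
∧ ∀ ρ : ℝ, 0 < ρ → ρ < ρ₀ → ∃ c : ℝ, 0 < c ∧ ∀ᶠ N : ℕ in Filter.atTop, ∃ δ : ENNReal, 0 < δ ∧ ∀ Ψ :
Literature.MathematicalPhysics.QuantumManyBody.BoseGas.PeriodicTrialState N
(Literature.MathematicalPhysics.QuantumManyBody.BoseGas.sideLength ρ N),
Literature.MathematicalPhysics.QuantumManyBody.BoseGas.periodicEnergy v Ψ ≤
Literature.MathematicalPhysics.QuantumManyBody.BoseGas.periodicGroundStateEnergy v N
(Literature.MathematicalPhysics.QuantumManyBody.BoseGas.sideLength ρ N) + δ → ENNReal.ofReal (c * N)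
≤ Literature.MathematicalPhysics.QuantumManyBody.BoseGas.condensateOccupation N
(Literature.MathematicalPhysics.QuantumManyBody.BoseGas.sideLength ρ N) Ψ.ψ) → ∃ ρ₀ : ℝ, 0 < ρ₀ ∧ ∀
ρ : ℝ, 0 < ρ → ρ < ρ₀ → Literature.MathematicalPhysics.QuantumManyBody.BoseGas.HasGroundStateBEC v
ρ)`

## Assembly
Real but short (est. 200–400 lines): from `kennedy_lieb_shastry_xy_ground_holds 3 _ 1 _` unfold
HasEvenTorusLRO/HasLongRangeOrder/torusPullback
(bijection `torusProj` on halfOpenBox) to get c₀ > 0 with Σ_{x,y} groundStateXYCorrTorus (2k) 1 x y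
≥ c₀(2k)^6 for large k; SectorMixtureBound
gives a sector N* ≤ V/2 with A(N*) ≥ c₀V²; HalfFillingMaximisesMoment gives A(V/2) ≥ c₀V²;
FractionDominatesHalfFilling gives
B(N) = A(N) + N − V/2 ≥ (2N/V)·A(V/2) ≥ 2c₀·N·V for 1 ≤ N ≤ V/2 — the antecedent of
LatticeToPeriodicBridge with c = 2c₀; the bridge yields
PeriodicBEC and `fun v hv => BoundaryTransferWeak v hv (PeriodicBEC v hv)` is the conjunct.

Rationale: WHY THIS LINE. The only interacting BEC theorem in a thermodynamic limit (KLS1988PRL /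
AizenmanEtAl2004, in the tree as `kennedy_lieb_shastry_xy_ground_holds`)
sits at the particle–hole symmetric point, and LSSY2005 Ch. 11 §11.1 records that nobody can leave
it because reflection positivity of a
STATE forces ⟨N⟩ = |Λ|/2 (tree lemma `rp_oddCharge_eq_zero`). This line keeps RP where it is a
theorem and moves in the conserved charge by
ORDER instead of symmetry: two inequalities comparing the unique positive (Perron–Frobenius,
stoquastic hopping) ground states of ADJACENT
number sectors of one Hamiltonian — a Lieb–Mattis / Nachtergaele–Spitzer–Starr-type "ordering across
sectors" statement (LiebMattis1962,
doi:10.1023/b:joss.0000037227.24460.e5), but for an order parameter (planar moment, condensate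
fraction) rather than an energy, and for
S³-sectors of the XY model rather than total-spin sectors. Imported areas: order/comparison methods
for positive ground states
(Perron–Frobenius, monotonicity in a conserved density), the ordering-of-levels literature as
template; the only rigorous filling
dependence in print, Toth1991 (λ_max ≤ N(V−N+1)/V), is one-sided and consistent. Nothing here needs
infrared bounds, energy asymptotics
or a gap, so KineticGapLengthScales / BogoliubovPerturbationInfrared do not bite on the lattice
half; the continuum pay-off is isolated in
ONE bridge crux whose intended mechanism (depth homotopy at fixed spacing b = 2R₀, filling ν = ρb³ →
0 with ρ) uses the all-fillings
theorem exactly where the sibling card cannot: in the dilute–dilute regime (arXiv:2602.16566 shows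
the dilute Bose–Hubbard gas already
shares the continuum's universal 4πaρ² law). Prior routes (BECInfraredBound, BECPeriodicReduction,
BECPinning, BECRenormGroup,
BECHardSphereComparison, BECPalmLandscape) are all continuum-internal; the negatives index is empty.

RANKED CRUXES. #0 UniformLatticeBEC (target) — X_lat — for every d ≥ 2 there are c > 0, L₀ with: for
all even L ≥ L₀ and all 1 ≤ N ≤ L^d/2, the sector-N ground state of the spin-½ XY ferromagnet on
(ℤ/Lℤ)^d (ground space of the penalised Hamiltonian) has ⟨S⁺_tot S⁻_tot⟩ = A_L(N) + N − L^d/2 ≥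
c·N·L^d (λ_max(γ_N) ≥ cN uniformly in the filling ≤ 1/2; fillings > 1/2 are the particle–hole image
and are not claimed). (why it might fail: it is LSSY's open 'BEC at other fillings'; false only if
dilute hard-core lattice bosons lose their condensate fraction as ν → 0 or L → ∞ (no mechanism
known, contradicts spin-wave theory and QMC) — or if the ∃L₀-guarded sector encoding misfires.)
[LSSY2005 Ch. 11 §11.1, AizenmanEtAl2004, KLS1988PRL, Toth1991, arXiv:2602.16566]
#2 FractionDominatesHalfFilling (crux) — (card conjecture M, endpoint form — exactly what the
assembly telescopes) for d ≥ 2 there is L₀ such that on every even torus of side L ≥ L₀ and for all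
1 ≤ N ≤ L^d/2: f_L(N) ≥ f_L(L^d/2), where f_L(N) = (A_L(N) + N − L^d/2)/(N·L^d) = λ_max(γ_N)/N is
the condensate fraction of the sector-N ground state; typed cross-multiplied: A_L(L^d/2)·N ≤ (A_L(N)
+ N − L^d/2)·(L^d/2). [difficulty: L] (why it might fail: no inequality comparing ground states of
different S³-sectors is known (Toth1991's upper bound is the only rigorous N-dependence); near N =
L^d/2 − j the margin is O(jL^d) against O(L^{2d}) terms, so any non-concavity of ρ₀(n) at
intermediate filling (d = 2 first) breaks it.) [KLS1988PRL, Toth1991, BernardetEtAl2002,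
doi:10.1103/physrevb.53.5826, LSSY2005 Ch. 11 §11.1]
#3 HalfFillingMaximisesMoment (crux) — (card conjecture C/D, endpoint form; makes the anchor's
unknown sector harmless) for d ≥ 2 there is L₀ such that on every even torus of side L ≥ L₀ and for
all N ≤ L^d/2: A_L(N) ≤ A_L(L^d/2) — among all magnetisation sectors the particle–hole-symmetric one
maximises the planar moment ⟨(S¹_tot)² + (S²_tot)²⟩ of its ground state (equivalently λ_max(γ_N) +
(L^d/2 − N)/L^d ≤ λ_max(γ_{L^d/2})). [difficulty: L] (why it might fail: A is flat at its symmetric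
maximum: A(V/2) − A(V/2−1) = O(1), set by the curvature ρ₀''(1/2) against finite-size terms;
ordering-across-sectors statements do fail at finite size (doi:10.1063/1.3699015), hence only ∃L₀;
no Lieb–Mattis theorem covers S³-sectors of the XY model.) [LiebMattis1962,
doi:10.1023/b:joss.0000037227.24460.e5, doi:10.1063/1.3699015, arXiv:1509.00907, KLS1988PRL]
#4 LatticeToPeriodicBridge (crux) — X_lat at d = 3 (uniform BEC of hard-core bosons on even 3-D tori
at all fillings ≤ 1/2) implies PeriodicBEC (for every repulsive finite-range v, small ρ, all large
N: every δ-near-minimiser of the periodic energy on the torus of side (N/ρ)^{1/3} has constant-mode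
occupation ≥ cN — the rank-2 item of route BECPeriodicReduction, verbatim as consequent). Intended
mechanism: optical-lattice depth homotopy H_λ = Σ_i(−Δ_i + λW(x_i/b)) + Σ_{i<j} v at FIXED spacing b
= 2R₀(v), filling ν = ρb³ (small with ρ): the deep end λ → ∞ at fixed (N, L) is the dilute hard-core
lattice gas, condensed by the antecedent uniformly in ν, and depth should only deplete (card
optical-lattice-depth-homotopy in its dilute–dilute regime). [deps: UniformLatticeBEC] [difficulty:
open-problem] (why it might fail: rests on an unproved sign — condensate monotone in the lattice
depth λ (false for tilted double wells; the top mode moves with λ) — plus a fixed-(N,L)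
tight-binding limit and an N-interpolation; as a bare implication it is as hard as PeriodicBEC
unless that sign is found.) [AizenmanEtAl2004, LSSY2005 Ch. 11, arXiv:2602.16566, Fournais2020,
doi:10.1007/s00220-006-0038-9]
#5 BoundaryTransferWeak (crux) — (shared item stmt-AtomisticToContinuum-0827 of route
BECPeriodicReduction, verbatim) for each repulsive finite-range v, PeriodicBEC(v) implies ∃ρ₀ > 0 ∀ρ
∈ (0, ρ₀), HasGroundStateBEC v ρ (Dirichlet ground state, λ_max(γ) ≥ cN via condensateNumber).
[deps: LatticeToPeriodicBridge] [difficulty: L] (why it might fail: PeriodicBEC(v) is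
ground-state-only at the box (N/ρ)^{1/3}: the Dirichlet ground state is a periodic trial state but
lies a wall term ≫ δ above E₀^per, and interior restrictions are neither periodic nor of sharp N;
BEC is boundary-condition sensitive (Robinson1976).) [LSSY2005 Ch. 2 after (2.8), Robinson1976,
LauwersVerbeureZagrebnov2003, Junge2026, BoccatoSeiringer2023]
#9 SectorMixtureBound (support) — for d ≥ 1 and even L, the all-sector (tracial) KLS planar moment
Σ_{x,y} groundStateXYCorrTorus L 1 x y is at most A_L(N) for some sector with 2N ≤ L^d: the global
ground projector of `xyTorus d L 1` is block-diagonal in S³_tot, each occupied block is the ground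
space of the penalised Hamiltonian, the tracial state is a convex combination of sector states, and
the spin flip (π-rotation about S¹) identifies A_L(N) = A_L(L^d − N). [difficulty: provable-now]
[KLS1988PRL, Tasaki2020 §2.1–2.2]
#9 FractionStepMonotone (support) — (the card's atomic conjecture M, single-step form; implies
FractionDominatesHalfFilling by telescoping N → N+1 → … → L^d/2) for d ≥ 2, large even L and 1 ≤ N <
N+1 ≤ L^d/2: B_L(N+1)/(N+1) ≤ B_L(N)/N with B_L(N) = A_L(N) + N − L^d/2 = ⟨S⁺_tot S⁻_tot⟩_N —
'adding a hard-core boson below half filling gains at most the current condensate fraction'.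
[difficulty: L] [KLS1988PRL, Toth1991, BernardetEtAl2002, doi:10.1103/physrevb.53.5826]
#9 PenaltySelectsSector (support) — (the encoding lemma every item uses) for d ≥ 1, L ≥ 1 and N ≤
L^d, every ground vector ψ of xyTorus d L 1 + (d+1)L^d·(S³_tot + (L^d/2 − N)·1)² satisfies (S³_tot +
(L^d/2 − N)·1)ψ = 0, i.e. lies in the sector of N bosons: the penalty (d+1)L^d exceeds the spectral
width ≤ 2‖H‖ ≤ (number of edges) ≤ d·L^d of the XY Hamiltonian (each bond S¹S¹+S²S² has norm 1/2),
and the sector is non-empty. [difficulty: provable-now] [Tasaki2020 §2.1, KLS1988PRL]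

TWO-LAYER PLAN. Foreseen glued splits (none filed now): FractionDominatesHalfFilling ⇐
FractionStepMonotone (support, telescoping glue); HalfFillingMaximisesMoment ⇐
MomentStepMonotone (A_L(N) ≤ A_L(N+1) for N+1 ≤ L^d/2, i.e. λ_max(γ_{N+1}) ≥ λ_max(γ_N) + 1/V) →
glue; LatticeToPeriodicBridge ⇐ DepthMonotoneFixedSpacing
→ DeepLatticeLimit → CommensurateInterpolation (k = 3; the first two become typable once a
`condensateNumber` with a one-body potential exists —
the sibling card's definition request; items to be SHARED with its route); SectorMixtureBound's
block decomposition / spin-flip lemmas ride as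
`--supports` helpers, never items. Alternative decomposition of the anchor step (if D dies): 'the
global XY ground state on even tori meets the
S³_tot = 0 sector' or a canonical-ensemble RP re-run of the tree's KLS proof with the RP-form
projector P₀ — a separate route sharing FractionDominatesHalfFilling.

KILL CRITERIA. A certified violation of FractionDominatesHalfFilling (sector ED / sign-free SSE-QMC:
some d ∈ {2,3}, even L ≥ 6, N ≤ V/2 with f_L(N) < f_L(V/2)
beyond error bars, persisting at the next size) closes the route
`refuted:FractionDominatesHalfFilling` — the line IS this inequality. A violation of
HalfFillingMaximisesMoment alone forces a pivot of the anchor step to the 'global ground state meets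
S³_tot = 0' lemma (route edit --restate), M kept.
A QMC-certified rise of n₀ with lattice depth at fixed b = 2R₀ and small filling refutes only the
intended mechanism of LatticeToPeriodicBridge
(pivot: bridge via a different regularisation, or hand X_lat to the depth route as its anchor).
PeriodicBEC or the conjunct proved elsewhere moots
the two continuum items but not X_lat; X_lat proved elsewhere (any method) closes ranks 0, 2, 3 as
moot-by-success.

NOT DECOMPOSED YET. The value of L₀(d) and of c (constants); the concavity variant C of the card (ρ₀
concave on [0,1]) — a stronger alternative to M ∧ D, filed only if
a prover asks; the positive-temperature random-loop version (card item L: FKG for the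
cosh(βμ|ℓ|/2)-tilted loop measure, d ≥ 3) — a different thesis;
fillings ν > 1/2 (particle–hole image, unused by the bridge); the Perron–Frobenius identification
λ_max(γ_N) = V⁻¹⟨S⁺_tot S⁻_tot⟩ (interpretation
only — the formal chain never needs λ_max of the lattice γ); every layer-2 child of the bridge
(depth monotonicity, tight-binding limit,
commensurability), which waits for the sibling route's definition request.

CHEAPEST FALSIFIER. Sector-resolved Lanczos ED of the spin-½ XY ferromagnet — all S³_tot sectors of
the 4×4 and 6×6 tori (d = 2) and of 4×4×2, 4×4×4 (N ≤ 10) —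
tabulating f_L(N) = ⟨S⁺_tot S⁻_tot⟩_N/(N V) and A_L(N): any N ≤ V/2 with f_L(N) < f_L(V/2) or A_L(N)
> A_L(V/2) at TWO consecutive sizes kills
ranks 2/3 (kit compute, minutes); then sign-free SSE/worm QMC on 8³–16³ for f(ν)/f(1/2), ν = 1/16 …
1/2. Not run here (plancard seat, one-shot);
literature proxy checked: the QMC curves ρ₀(n) of BernardetEtAl2002 (2-D) and Pedersen–Schneider
doi:10.1103/physrevb.53.5826 (3-D) look concave
with maximum at n = 1/2 (card + audit-12), consistent with M and D.

NUMBERS. Rigorous: Toth1991 λ_max(γ_N) ≤ N(V−N+1)/V, i.e. ρ₀(n) ≤ n(1−n) + n/V (one-sided, monotone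
in N, consistent); free lattice gas f ≡ 1; anchor constant
from LSSY2005 (11.26) at λ = 0, β → ∞, d = 3: V⁻²A(V/2) ≥ 1/2 − (1/2)(√3·W)^{1/2} ≈ 0.032 with W ≈
0.5055 the simple-cubic Watson integral, so the
transported bound is f(ν) ≥ 2 × 0.032 ≈ 0.06 at every filling ≤ 1/2 (spin-wave/QMC values are ≈ 10×
larger). Items at open: 9 (1 target,
4 cruxes, 3 support, 1 assembly).

DEFINITION REQUESTS. None filed: the sector ground state is encoded by the penalty (d+1)L^d·(S³_tot
+ (L^d/2 − N)·1)² over existing `xyTorus`, `totalSpin`,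
`Matrix.groundStateFunctional`, `Matrix.groundSpace` (all statements rc 0 in Sketch.lean). A
Literature notion `sectorGroundStateFunctional`
(QuantumLattice) would abbreviate every item but is not requested, to avoid restating filed
signatures. The bridge's layer-2 children need the
sibling card's `energyWithPotential` / `condensateNumberW` (its request, not duplicated here).

Novelty: Searches (2026-08-15): zbMATH 'hard core Bose lattice condensate' (6: AizenmanEtAl2004 ×2 editions,
Fernández–Fröhlich–Ueltschi doi:10.1007/s00220-006-0038-9,
Toth1991, Seiringer2013, Moseley–Fialko–Ziegler 2008); zbMATH 'ordering of energy levels XXZ' (3)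
and 'ferromagnetic ordering of energy levels' (8:
NSS 2004 doi:10.1023/b:joss.0000037227.24460.e5, Nachtergaele–Starr 2005, Spitzer–Starr–Tran
counterexamples doi:10.1063/1.3699015, asymptotic FOEL
arXiv:1509.00907); zbMATH 'monotonicity condensate density bosons' (1, Frank–Lemm–Simon fermion
pairs, unrelated); zbMATH 'derivation Bose-Hubbard
model optical lattice' (0); Crossref 'hard-core bosons condensate fraction filling QMC' (10 physics
rows incl. doi:10.1103/physrevb.53.5826); Crossref
'XY model magnetization sector transverse LRO' (8, none relevant); `lit frontier
AtomisticToContinuum --since 2022` (30; relevant arXiv:2602.16566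
dilute Bose–Hubbard 4πaρ² universality, arXiv:2603.20776, arXiv:2510.20493); local hybrid 'hard-core
bosons half filling reflection positivity other
fillings' (LSSY2005 pp. 116–117 held); `lean search` (kennedy_lieb_shastry_*, hardCoreLatticeGas,
totalSpin, groundStateFunctional, minEnergyOn);
OpenAlex/arXiv/S2 returned HTTP 429 and `lit galaxy search` was queue-saturated (> 90 s) at filing —
recorded, not worked around; the card's
audit-12 searches (zbMATH/Crossref, Rios et al. 2024 saturation of Tóth's bound) are inherited.
Nearest prior art found: KLS1988PRL / KennedyLiebShastry1988 (anchor  [refs: 10.1007/s00220-006-0038-9, 10.1023/b:joss.0000037227.24460.e5, 10.1063/1.3699015, 10.1103/physrevb.53.5826, 1509.00907, 2602.16566, 2603.20776, 2510.20493, doi:10.1007/s00220-006-0038-9, doi:10.1023/b, doi:10.1063/1.3699015, doi:10.1103/physrevb.53.5826, AizenmanEtAl2004, Toth1991, Seiringer2013, LSSY2005, KennedyLiebShastry1988, LiebMattis1962]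

Barriers (technique_class: sector-comparison monotonicity RP-anchor depth-homotopy): - technique_class: sector-comparison monotonicity RP-anchor depth-homotopy
- Literature.Barriers.AtomisticToContinuum.HalfFillingReflectionPositivity: used as the ANCHOR only
(KLS at S³_tot = 0, a theorem of the tree, within the entry's scope_caveats); the extension in the
filling is by comparison inequalities between sector ground states that invoke no reflection, hence
outside the RP/Gaussian-domination class by construction — honest: no tool for the comparison exists
yet, the bet is Perron–Frobenius positivity of adjacent-sector ground states of one stoquastic
Hamiltonian.
- Literature.Barriers.AtomisticToContinuum.HalfFillingReflectionPositivityNarrow: its conjunct (2)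
(`rp_oddCharge_eq_zero`: an RP state has ⟨N⟩ = |Λ|/2) is exactly why doped sectors are reached by
order and never by RP; the route asserts RP nowhere off half filling.
- Literature.Barriers.AtomisticToContinuum.SymmetryBreakingWithoutCondensate: not met — canonical
sectors, zero source field; the order parameter is ⟨S⁺_tot S⁻_tot⟩ = V·λ_max of the
particle-conserving ground state.
- Literature.Barriers.AtomisticToContinuum.HohenbergLowDimension: consistent — T = 0 throughout;
nothing at positive temperature is claimed (the card's loop version, d ≥ 3, is deliberately not
filed).
- Literature.Barriers.AtomisticToContinuum.PitaevskiiStringariOneDimension: consistent — lattice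
items are stated for d ≥ 2 only (KLS range) and the bridge for d = 3; in d = 1 the anchor fails and
Jordan–Wigner parity effects would e

History (route lifecycle, newest last):
- 2026-08-15T13:38:43Z · CLOSED retired — not-a-thesis: assembly does not conclude the sub-problem Statement (operator:999:1257524)

sub-problem: BoseEinsteinCondensation · status: closed(retired) · opened planner-plancard-AtomisticToContinuum-BoseEin-88822eff-0 2026-08-15T11:39:00Z · rev 0 · ledger route-AtomisticToContinuum-BECFillingMonotone
GENERATED by the gate from the ledger (D-0016/17). Provers cite these decls: `theorem foo : Summit.AtomisticToContinuum.BoseEinsteinCondensation.Theses.BECFillingMonotone.<Decl> := …` in Summits/AtomisticToContinuum/BoseEinsteinCondensation/Theorems/<Name>.lean.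
-/

namespace Summit.AtomisticToContinuum.BoseEinsteinCondensation.Theses.BECFillingMonotone

open scoped BigOperators Topology Manifold Classical MeasureTheory ProbabilityTheory Matrix InnerProductSpace ComplexConjugate ContinuousMap
open Filter Set Function TopologicalSpace MeasureTheory

attribute [summit_statement] _root_.BoseEinsteinCondensation

/-- item stmt-AtomisticToContinuum-5005 · target · rank 0 · closed · moot by None · by planner
why it might fail: it is LSSY's open 'BEC at other fillings'; false only if dilute hard-core lattice bosons lose their condensate fraction as ν → 0 or L → ∞ (no mechanism known, contradicts spin-wave theory and QMC) — or if the ∃L₀-guarded sector encoding misfires.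
sources: LSSY2005 Ch. 11 §11.1, AizenmanEtAl2004, KLS1988PRL, Toth1991, arXiv:2602.16566
[target] X_lat — for every d ≥ 2 there are c > 0, L₀ with: for all even L ≥ L₀ and all 1 ≤ N ≤
L^d/2, the sector-N ground state of the spin-½ XY ferromagnet on (ℤ/Lℤ)^d (ground space of the
penalised Hamiltonian) has ⟨S⁺_tot S⁻_tot⟩ = A_L(N) + N − L^d/2 ≥ c·N·L^d (λ_max(γ_N) ≥ cN uniformly
in the filling ≤ 1/2; fillings > 1/2 are the particle–hole image and are not claimed). -/
@[route_item "route-AtomisticToContinuum-BECFillingMonotone"]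
def UniformLatticeBEC : Prop :=
  ∀ d : ℕ, 2 ≤ d → ∃ c : ℝ, 0 < c ∧ ∃ L₀ : ℕ, ∀ (L : ℕ) [NeZero L], L₀ ≤ L → Even L → ∀ N : ℕ, 1 ≤ N → 2 * N ≤ L ^ d → c * N * (L : ℝ) ^ d ≤ ((Literature.MathematicalPhysics.QuantumLattice.xyTorus d L 1 + (((d + 1) * L ^ d : ℕ) : ℂ) • (Literature.MathematicalPhysics.QuantumLattice.totalSpin 1 2 + ((L : ℂ) ^ d / 2 - (N : ℂ)) • 1) ^ 2).groundStateFunctional (Literature.MathematicalPhysics.QuantumLattice.totalSpin 1 0 * Literature.MathematicalPhysics.QuantumLattice.totalSpin 1 0 + Literature.MathematicalPhysics.QuantumLattice.totalSpin 1 1 * Literature.MathematicalPhysics.QuantumLattice.totalSpin 1 1)).re + N - (L : ℝ) ^ d / 2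

/-- item stmt-AtomisticToContinuum-5006 · crux · rank 2 · closed · moot by None · by planner
why it might fail: no inequality comparing ground states of different S³-sectors is known (Toth1991's upper bound is the only rigorous N-dependence); near N = L^d/2 − j the margin is O(jL^d) against O(L^{2d}) terms, so any non-concavity of ρ₀(n) at intermediate filling (d = 2 first) breaks it.
sources: KLS1988PRL, Toth1991, BernardetEtAl2002, doi:10.1103/physrevb.53.5826, LSSY2005 Ch. 11 §11.1
[crux] (card conjecture M, endpoint form — exactly what the assembly telescopes) for d ≥ 2 there is
L₀ such that on every even torus of side L ≥ L₀ and for all 1 ≤ N ≤ L^d/2: f_L(N) ≥ f_L(L^d/2),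
where f_L(N) = (A_L(N) + N − L^d/2)/(N·L^d) = λ_max(γ_N)/N is the condensate fraction of the
sector-N ground state; typed cross-multiplied: A_L(L^d/2)·N ≤ (A_L(N) + N − L^d/2)·(L^d/2).
[difficulty: L] -/
@[route_item "route-AtomisticToContinuum-BECFillingMonotone"]
def FractionDominatesHalfFilling : Prop :=
  ∀ d : ℕ, 2 ≤ d → ∃ L₀ : ℕ, ∀ (L : ℕ) [NeZero L], L₀ ≤ L → Even L → ∀ N : ℕ, 1 ≤ N → 2 * N ≤ L ^ d → let A : ℕ → ℝ := (fun M => ((Literature.MathematicalPhysics.QuantumLattice.xyTorus d L 1 + (((d + 1) * L ^ d : ℕ) : ℂ) • (Literature.MathematicalPhysics.QuantumLattice.totalSpin 1 2 + ((L : ℂ) ^ d / 2 - (M : ℂ)) • 1) ^ 2).groundStateFunctional (Literature.MathematicalPhysics.QuantumLattice.totalSpin 1 0 * Literature.MathematicalPhysics.QuantumLattice.totalSpin 1 0 + Literature.MathematicalPhysics.QuantumLattice.totalSpin 1 1 * Literature.MathematicalPhysics.QuantumLattice.totalSpin 1 1)).re); A (L ^ d / 2) * (N : ℝ) ≤ (A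 N + N - (L : ℝ) ^ d / 2) * ((L : ℝ) ^ d / 2)

/-- item stmt-AtomisticToContinuum-5007 · crux · rank 3 · closed · moot by None · by planner
why it might fail: A is flat at its symmetric maximum: A(V/2) − A(V/2−1) = O(1), set by the curvature ρ₀''(1/2) against finite-size terms; ordering-across-sectors statements do fail at finite size (doi:10.1063/1.3699015), hence only ∃L₀; no Lieb–Mattis theorem covers S³-sectors of the XY model.
sources: LiebMattis1962, doi:10.1023/b:joss.0000037227.24460.e5, doi:10.1063/1.3699015, arXiv:1509.00907, KLS1988PRL
[crux] (card conjecture C/D, endpoint form; makes the anchor's unknown sector harmless) for d ≥ 2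
there is L₀ such that on every even torus of side L ≥ L₀ and for all N ≤ L^d/2: A_L(N) ≤ A_L(L^d/2)
— among all magnetisation sectors the particle–hole-symmetric one maximises the planar moment
⟨(S¹_tot)² + (S²_tot)²⟩ of its ground state (equivalently λ_max(γ_N) + (L^d/2 − N)/L^d ≤
λ_max(γ_{L^d/2})). [difficulty: L] -/
@[route_item "route-AtomisticToContinuum-BECFillingMonotone"]
def HalfFillingMaximisesMoment : Prop :=
  ∀ d : ℕ, 2 ≤ d → ∃ L₀ : ℕ, ∀ (L : ℕ) [NeZero L], L₀ ≤ L → Even L → ∀ N : ℕ, 2 * N ≤ L ^ d → let A : ℕ → ℝ := (fun M => ((Literature.MathematicalPhysics.QuantumLattice.xyTorus d L 1 + (((d + 1) * L ^ d : ℕ) : ℂ) • (Literature.MathematicalPhysics.QuantumLattice.totalSpin 1 2 + ((L : ℂ) ^ d / 2 - (M : ℂ)) • 1) ^ 2).groundStateFunctional (Literature.MathematicalPhysics.QuantumLattice.totalSpin 1 0 * Literature.MathematicalPhysics.QuantumLattice.totalSpin 1 0 + Literature.MathematicalPhysics.QuantumLattice.totalSpin 1 1 * Literature.MathematicalPhysics.QuantumLattice.totalSpin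 1 1)).re); A N ≤ A (L ^ d / 2)

/-- item stmt-AtomisticToContinuum-5008 · crux · rank 4 · closed · moot by None · by planner
why it might fail: rests on an unproved sign — condensate monotone in the lattice depth λ (false for tilted double wells; the top mode moves with λ) — plus a fixed-(N,L) tight-binding limit and an N-interpolation; as a bare implication it is as hard as PeriodicBEC unless that sign is found.
sources: AizenmanEtAl2004, LSSY2005 Ch. 11, arXiv:2602.16566, Fournais2020, doi:10.1007/s00220-006-0038-9
[crux] X_lat at d = 3 (uniform BEC of hard-core bosons on even 3-D tori at all fillings ≤ 1/2)
implies PeriodicBEC (for every repulsive finite-range v, small ρ, all large N: every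
δ-near-minimiser of the periodic energy on the torus of side (N/ρ)^{1/3} has constant-mode
occupation ≥ cN — the rank-2 item of route BECPeriodicReduction, verbatim as consequent). Intended
mechanism: optical-lattice depth homotopy H_λ = Σ_i(−Δ_i + λW(x_i/b)) + Σ_{i<j} v at FIXED spacing b
= 2R₀(v), filling ν = ρb³ (small with ρ): the deep end λ → ∞ at fixed (N, L) is the dilute hard-core
lattice gas, condensed by the antecedent uniformly in ν, and depth should only deplete (card
optical-lattice-depth-homotopy in its dilute–dilute regime). [deps: UniformLatticeBEC] [difficulty:
open-problem] -/
@[route_item "route-AtomisticToContinuum-BECFillingMonotone"]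
def LatticeToPeriodicBridge : Prop :=
  (∃ c : ℝ, 0 < c ∧ ∃ L₀ : ℕ, ∀ (L : ℕ) [NeZero L], L₀ ≤ L → Even L → ∀ N : ℕ, 1 ≤ N → 2 * N ≤ L ^ 3 → c * N * (L : ℝ) ^ 3 ≤ ((Literature.MathematicalPhysics.QuantumLattice.xyTorus 3 L 1 + (((3 + 1) * L ^ 3 : ℕ) : ℂ) • (Literature.MathematicalPhysics.QuantumLattice.totalSpin 1 2 + ((L : ℂ) ^ 3 / 2 - (N : ℂ)) • 1) ^ 2).groundStateFunctional (Literature.MathematicalPhysics.QuantumLattice.totalSpin 1 0 * Literature.MathematicalPhysics.QuantumLattice.totalSpin 1 0 + Literature.MathematicalPhysics.QuantumLattice.totalSpin 1 1 * Literature.MathematicalPhysics.QuantumLattice.totalSpin 1 1)).re + N - (L : ℝ) ^ 3 / 2) → ∀ v : ℝ → ENNReal, Literature.MathematicalPhysics.QuantumManyBody.BoseGas.IsRepulsiveFiniteRange v → ∃ ρ₀ : ℝ, 0 < ρ₀ ∧ ∀ ρ : ℝ, 0 < ρ → ρ < ρ₀ → ∃ c : ℝ, 0 < c ∧ ∀ᶠ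 N : ℕ in Filter.atTop, ∃ δ : ENNReal, 0 < δ ∧ ∀ Ψ : Literature.MathematicalPhysics.QuantumManyBody.BoseGas.PeriodicTrialState N (Literature.MathematicalPhysics.QuantumManyBody.BoseGas.sideLength ρ N), Literature.MathematicalPhysics.QuantumManyBody.BoseGas.periodicEnergy v Ψ ≤ Literature.MathematicalPhysics.QuantumManyBody.BoseGas.periodicGroundStateEnergy v N (Literature.MathematicalPhysics.QuantumManyBody.BoseGas.sideLength ρ N) + δ → ENNReal.ofReal (c * N) ≤ Literature.MathematicalPhysics.QuantumManyBody.BoseGas.condensateOccupation N (Literature.MathematicalPhysics.QuantumManyBody.BoseGas.sideLength ρ N) Ψ.ψ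

/-- item stmt-AtomisticToContinuum-0827 · crux · rank 5 · open · by planner
why it might fail: PeriodicBEC(v) is ground-state-only at the box (N/ρ)^{1/3}: the Dirichlet ground state is a periodic trial state but lies a wall term ≫ δ above E₀^per, and interior restrictions are neither periodic nor of sharp N; BEC is boundary-condition sensitive (Robinson1976).
sources: LSSY2005 Ch. 2 after (2.8), Robinson1976, LauwersVerbeureZagrebnov2003, Junge2026, BoccatoSeiringer2023
[crux] BoundaryTransferWeak (mode-free boundary-condition transfer, per potential): for each
repulsive finite-range v, PeriodicBEC(v) implies ∃ρ₀>0 ∀ρ∈(0,ρ₀) HasGroundStateBEC v ρ (Dirichlet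
ground state, λ_max(γ) ≥ cN via condensateNumber). Not glue: near-minimiser slacks are O(N/L²) while
Dirichlet/periodic energies differ by a boundary term ≫ N/L², so no energy-comparison proof;
expected route: Neumann bracketing of interior sub-boxes (−Δ_Dir ≥ ⊕−Δ_Neu, v ≥ 0) + a mode-free
criterion (λ_max ≥ tr γ²/N). Only the ENERGY analogue is in print (LiebSeiringerSolovejYngvason2005
Ch. 2 after (2.8)). v ≡ 0: hypothesis and conclusion both true. -/
@[route_item "route-AtomisticToContinuum-BECFillingMonotone"]
def BoundaryTransferWeak : Prop :=
  ∀ v : ℝ → ENNReal, Literature.MathematicalPhysics.QuantumManyBody.BoseGas.IsRepulsiveFiniteRange v → (∃ ρ₀ : ℝ, 0 < ρ₀ ∧ ∀ ρ : ℝ, 0 < ρ → ρ < ρ₀ → ∃ c : ℝ, 0 < c ∧ ∀ᶠ N : ℕ in Filter.atTop, ∃ δ : ENNReal, 0 < δ ∧ ∀ Ψ : Literature.MathematicalPhysics.QuantumManyBody.BoseGas.PeriodicTrialState N (Literature.MathematicalPhysics.QuantumManyBody.BoseGas.sideLength ρ N), Literature.MathematicalPhysics.QuantumManyBody.BoseGas.periodicEnergy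 v Ψ ≤ Literature.MathematicalPhysics.QuantumManyBody.BoseGas.periodicGroundStateEnergy v N (Literature.MathematicalPhysics.QuantumManyBody.BoseGas.sideLength ρ N) + δ → ENNReal.ofReal (c * N) ≤ Literature.MathematicalPhysics.QuantumManyBody.BoseGas.condensateOccupation N (Literature.MathematicalPhysics.QuantumManyBody.BoseGas.sideLength ρ N) Ψ.ψ) → ∃ ρ₀ : ℝ, 0 < ρ₀ ∧ ∀ ρ : ℝ, 0 < ρ → ρ < ρ₀ → Literature.MathematicalPhysics.QuantumManyBody.BoseGas.HasGroundStateBEC v ρ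

/-- item stmt-AtomisticToContinuum-5009 · support · rank 9 · closed · moot by None · by planner
sources: KLS1988PRL, Tasaki2020 §2.1–2.2
[support] for d ≥ 1 and even L, the all-sector (tracial) KLS planar moment Σ_{x,y}
groundStateXYCorrTorus L 1 x y is at most A_L(N) for some sector with 2N ≤ L^d: the global ground
projector of `xyTorus d L 1` is block-diagonal in S³_tot, each occupied block is the ground space of
the penalised Hamiltonian, the tracial state is a convex combination of sector states, and the spin
flip (π-rotation about S¹) identifies A_L(N) = A_L(L^d − N). [difficulty: provable-now] -/
@[route_item "route-AtomisticToContinuum-BECFillingMonotone"]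
def SectorMixtureBound : Prop :=
  ∀ (d L : ℕ) [NeZero L], 1 ≤ d → Even L → ∃ N : ℕ, 2 * N ≤ L ^ d ∧ ∑ x : Literature.Probability.LatticeModels.TorusSite d L, ∑ y : Literature.Probability.LatticeModels.TorusSite d L, Literature.MathematicalPhysics.QuantumLattice.groundStateXYCorrTorus L 1 x y ≤ ((Literature.MathematicalPhysics.QuantumLattice.xyTorus d L 1 + (((d + 1) * L ^ d : ℕ) : ℂ) • (Literature.MathematicalPhysics.QuantumLattice.totalSpin 1 2 + ((L : ℂ) ^ d / 2 - (N : ℂ)) • 1) ^ 2).groundStateFunctional (Literature.MathematicalPhysics.QuantumLattice.totalSpin 1 0 * Literature.MathematicalPhysics.QuantumLattice.totalSpin 1 0 + Literature.MathematicalPhysics.QuantumLattice.totalSpin 1 1 * Literature.MathematicalPhysics.QuantumLattice.totalSpin 1 1)).re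

/-- item stmt-AtomisticToContinuum-5010 · support · rank 9 · closed · moot by None · by planner
sources: KLS1988PRL, Toth1991, BernardetEtAl2002, doi:10.1103/physrevb.53.5826
[support] (the card's atomic conjecture M, single-step form; implies FractionDominatesHalfFilling by
telescoping N → N+1 → … → L^d/2) for d ≥ 2, large even L and 1 ≤ N < N+1 ≤ L^d/2: B_L(N+1)/(N+1) ≤
B_L(N)/N with B_L(N) = A_L(N) + N − L^d/2 = ⟨S⁺_tot S⁻_tot⟩_N — 'adding a hard-core boson below half
filling gains at most the current condensate fraction'. [difficulty: L] -/
@[route_item "route-AtomisticToContinuum-BECFillingMonotone"]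
def FractionStepMonotone : Prop :=
  ∀ d : ℕ, 2 ≤ d → ∃ L₀ : ℕ, ∀ (L : ℕ) [NeZero L], L₀ ≤ L → Even L → ∀ N : ℕ, 1 ≤ N → 2 * (N + 1) ≤ L ^ d → let B : ℕ → ℝ := (fun M => ((Literature.MathematicalPhysics.QuantumLattice.xyTorus d L 1 + (((d + 1) * L ^ d : ℕ) : ℂ) • (Literature.MathematicalPhysics.QuantumLattice.totalSpin 1 2 + ((L : ℂ) ^ d / 2 - (M : ℂ)) • 1) ^ 2).groundStateFunctional (Literature.MathematicalPhysics.QuantumLattice.totalSpin 1 0 * Literature.MathematicalPhysics.QuantumLattice.totalSpin 1 0 + Literature.MathematicalPhysics.QuantumLattice.totalSpin 1 1 * Literature.MathematicalPhysics.QuantumLattice.totalSpin 1 1)).re + M - (L : ℝ) ^ d / 2); B (N + 1) * (N : ℝ) ≤ B N * ((N : ℝ) + 1)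

/-- item stmt-AtomisticToContinuum-5011 · support · rank 9 · closed · moot by None · by planner
sources: Tasaki2020 §2.1, KLS1988PRL
[support] (the encoding lemma every item uses) for d ≥ 1, L ≥ 1 and N ≤ L^d, every ground vector ψ
of xyTorus d L 1 + (d+1)L^d·(S³_tot + (L^d/2 − N)·1)² satisfies (S³_tot + (L^d/2 − N)·1)ψ = 0, i.e.
lies in the sector of N bosons: the penalty (d+1)L^d exceeds the spectral width ≤ 2‖H‖ ≤ (number of
edges) ≤ d·L^d of the XY Hamiltonian (each bond S¹S¹+S²S² has norm 1/2), and the sector is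
non-empty. [difficulty: provable-now] -/
@[route_item "route-AtomisticToContinuum-BECFillingMonotone"]
def PenaltySelectsSector : Prop :=
  ∀ (d L : ℕ) [NeZero L] (N : ℕ), 1 ≤ d → N ≤ L ^ d → ∀ ψ : Literature.MathematicalPhysics.QuantumLattice.TensorIndex (Literature.Probability.LatticeModels.TorusSite d L) 2 → ℂ, ψ ∈ (Literature.MathematicalPhysics.QuantumLattice.xyTorus d L 1 + (((d + 1) * L ^ d : ℕ) : ℂ) • (Literature.MathematicalPhysics.QuantumLattice.totalSpin 1 2 + ((L : ℂ) ^ d / 2 - (N : ℂ)) • 1) ^ 2).groundSpace → (Literature.MathematicalPhysics.QuantumLattice.totalSpin (Λ := Literature.Probability.LatticeModels.TorusSite d L) 1 2 + ((L : ℂ) ^ d / 2 - (N : ℂ)) • 1).mulVec ψ = 0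

/-- item stmt-AtomisticToContinuum-5012 · assembly · rank 1 · closed · moot by None · by planner
sources: KLS1988PRL, LSSY2005 §1.2 and Ch. 11
[assembly] FractionDominatesHalfFilling → HalfFillingMaximisesMoment → SectorMixtureBound →
LatticeToPeriodicBridge → BoundaryTransferWeak → BoseEinsteinCondensation (uses the tree theorem
kennedy_lieb_shastry_xy_ground_holds at d = 3, n = 1 inside the proof). -/
@[route_item "route-AtomisticToContinuum-BECFillingMonotone"]
def Assembly : Prop :=
  FractionDominatesHalfFilling → HalfFillingMaximisesMoment → SectorMixtureBound → LatticeToPeriodicBridge → BoundaryTransferWeak → Literature.MathematicalPhysics.QuantumManyBody.BoseGas.BoseEinsteinCondensation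

end Summit.AtomisticToContinuum.BoseEinsteinCondensation.Theses.BECFillingMonotone
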